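import Mathlib
import HarnessLib
import Literature.Analysis.Calculus.IteratedFDerivSymmetric

/-!
# Symmetry of the second and third jets of a smooth vector field on `ℝ³`

Calculus; Mathlib only (plus the tree's all-orders Schwarz–Clairaut theorem
`Literature.Analysis.Calculus.iteratedFDeriv_comp_perm_of_contDiff`, itself proved from Mathlib's
`ContDiffAt.isSymmSndFDerivAt`); no named facts.

Crux `OddMorawetzLocal` (item stmt-NavierStokesRegularity-1376), refutation skeleton, stub `stub_jet_symm`:
for a `C^∞` field `v : ℝ³ → ℝ³` and a point `x`, the continuous multilinear maps `D²v(x)` and `D³v(x)`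
(Mathlib's `iteratedFDeriv ℝ 2 v x`, `iteratedFDeriv ℝ 3 v x`) are symmetric under every permutation of
their slots.  This identifies the abstract jet `(v x, Dv x, D²v x, D³v x)` with the symmetric jet
coordinates `∂^α v_a (x)` in which the refutation writes a smooth local density as a polynomial.

Both conjuncts are the orders `m = 2, 3 ≤ ∞` of the general statement
`D^m f(x)(w ∘ σ) = D^m f(x)(w)` for `f` of class `C^n`, `m ≤ n`.
-/

noncomputable section

set_option linter.dupNamespace false

namespace Summit.NavierStokesRegularity.NavierStokesRegularity.Theorems

/-- **Symmetry of the second and third jets** (stub `stub_jet_symm` of crux `OddMorawetzLocal`).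
For a smooth (`C^∞`) vector field `v : ℝ³ → ℝ³` and every point `x`:
`D²v(x)(w ∘ σ) = D²v(x)(w)` for all `w : Fin 2 → ℝ³`, `σ ∈ 𝔖₂`, and
`D³v(x)(w ∘ σ) = D³v(x)(w)` for all `w : Fin 3 → ℝ³`, `σ ∈ 𝔖₃` (Schwarz–Clairaut; the orders `2` and `3`
of `Literature.Analysis.Calculus.iteratedFDeriv_comp_perm_of_contDiff`). -/
theorem iteratedFDeriv_symm_two_three (v : EuclideanSpace ℝ (Fin 3) → EuclideanSpace ℝ (Fin 3))
    (hv : ContDiff ℝ (⊤ : ℕ∞) v) (x : EuclideanSpace ℝ (Fin 3)) :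
    (∀ (w : Fin 2 → EuclideanSpace ℝ (Fin 3)) (σ : Equiv.Perm (Fin 2)),
        iteratedFDeriv ℝ 2 v x (w ∘ σ) = iteratedFDeriv ℝ 2 v x w) ∧
      (∀ (w : Fin 3 → EuclideanSpace ℝ (Fin 3)) (σ : Equiv.Perm (Fin 3)),
        iteratedFDeriv ℝ 3 v x (w ∘ σ) = iteratedFDeriv ℝ 3 v x w) :=
  ⟨fun w σ => Literature.Analysis.Calculus.iteratedFDeriv_comp_perm_of_contDiff hv
      (WithTop.coe_le_coe.2 le_top) x w σ,
    fun w σ => Literature.Analysis.Calculus.iteratedFDeriv_comp_perm_of_contDiff hv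
      (WithTop.coe_le_coe.2 le_top) x w σ⟩

end Summit.NavierStokesRegularity.NavierStokesRegularity.Theorems

end
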